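import Literature.MathematicalPhysics.QuantumFieldTheory.Balaban1983to89.T4ContinuumYM4Torus
import Summits.QuantumFields.BalabanUV.Gaps.EndUpperPerLevel
import Summits.QuantumFields.BalabanUV.Gaps.EndContAlongFoliation

/-!
# Gaps / EndFoliationHeadline — the T⁴ headline's β-binders `hEnd` ∕ B4 `hC` (and [I] Thm 2's printed shape) from letters on ONE one-parameter
# family: continuity, bounds and the sign (or (PS)) of the countably many ONE-VARIABLE traces `x ↦ β_k(ĝ(Y_0(x)),…,ĝ(Y_k(x)))` of the datum's own family
# `D.βfun` along the γ₀-clamped forward shooting foliation — the combined weakenings of `Gaps/EndContAlongFoliation` + `Gaps/EndUpperPerLevel`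
# (g1-plan-2 GEN 18's S-45 ∕ S-44 readings, ported there and in §1 here) and their datum-level transport, as `Gaps/EndRunwiseHeadline` was for
# the gen-6 currencies
# (cell pub-balaban-gaps, seat g1-p3 gen 7, row CAP+tail ∕ β-currency «split ∕ weakening»; file 4 of «the binder census of the END roads»)

HONEST FRAMING (cell rule, page 1 of everything): the target is ONE kernel implication on ONE finite four-torus of fixed physical size —
`T4ContinuumYM4Torus.continuumYM4_torus_of_endpointExistence` — whose binders (B1) `hD`, (B) `hB`, `hEnd`, (NE7-slot) `hNE` are OPEN.  This
module DISCHARGES NOTHING: it feeds `hEnd` from β-side hypotheses on the datum's OWN family `D.βfun` that live on a ONE-PARAMETER family of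
histories (the γ₀-clamped forward shooting prefixes from the trial bare coupling) instead of on the (k+1)-dimensional boxes — every one a
BINDER, instance 0∕1 for Bałaban's family; the other binders stay hypotheses verbatim.  For Bałaban's β, continuity (indeed analyticity) in
the coupling and the uniform upper bound are ASSERTED in print ([I] §1 pp. 263–264; no located proof — GAPS G-adv2-3 ∕ G-adv2-6) and the
sign ∕ asymptotic freedom of the full β is [I] Thm 2's unprinted input (rows CAP ∕ tail ∕ (D1) ∕ (D4)): NO word of record moves.  [I] Thm 2
is UNPROVED in print; 0∕13 main theorems, 0∕9 spine estimates, 0∕6 binders; one finite T⁴; NOT ℝ⁴, NOT infinite volume, NOT a mass gap,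
NOT Clay.
HONEST DEPENDENCY (b2b cell, verbatim): «continuum YM on T⁴ ⇐ BetaPertH ∧ nine spine estimates (0/9 proved); BetaPertH ⇐ (D1) ∧ (D4) ∧
CAP+tail; G-an2-4 gates asym, D1 and NE2/3/4.»

CONTENT (forward generation is the datum's FIELD `D.fwd`, the dictionary its FIELD `D.curries`; `HaltsOutside` enters the iff as a
hypothesis, as in `Gaps/EndRunwiseHeadline`):
* §1 (construction level; PORTED VERBATIM, with attribution, from g1-plan-2 GEN 18's lens kernel `HOME/g1/skeletons/XreadHordFadingMemory_plan2.lean`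
  v1.8 4a2dd778a9e40b0b §13 — the two declarations that combine `Gaps/EndContAlongFoliation` with `Gaps/EndUpperPerLevel`, kept out of the former so
  that each of those leaves imports (D) only): `endpointExistence_iff_topRuns_foliation_locUpper` ((D)'s criterion with trace continuity AND per-level
  trace bounds, no `0 ≤ β′`), `endpointExistence_of_foliationLetters_locUpper` (the W-β road with (C), per-level (U), (PS) along the foliation).
* §2 (construction level, `ForwardGenerated` only; this seat) `endpointExistence_of_foliationSign` — the SIGN socket with ALL THREE letters on
  the foliation: `0 ≤ β_k`, `β_k ≤ B_k` and continuity asked only of the traces `x ↦ β_k(clampPrefix β γ₀ k x)` on `]0,γ₀]` ⟹ `EndpointExistence C`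
  (§1's `endpointExistence_of_foliationLetters_locUpper` with `M = 0`).
* §2b (construction level; this seat) `thm2Printed_of_runs` (THEOREM-2 TRANSFER along shared in-interval runs, the (0.31) companion of
  `EndContAlongFoliation.endpointExistence_of_runs`), **`thm2Printed_of_foliationBounds`** — [I] Thm 2's printed shape `B12.Thm2Printed C L` from
  `0 < b ≤ trace ≤ β′` + continuity asked only of the one-variable traces (`FlowStepRuns.thm2Printed_of_boxBoundsH` :211 on `folH` + transfer):
  the located unprinted β-input of rows CAP ∕ tail ∕ (D1) ∕ (D4) in a weaker placement on the Theorem-2 node (weakest so far in the tree; g1-plan-2's S-48 moves it further, to the survivor sets); `betaLowerH_folH` ∕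
  `folLower_of_betaLowerH` (the lower letter, trace ⟺ box for `folH`); `endpointExistence_of_thm2Printed` (Thm 2's shape contains the END; ported
  from g1-plan-2's kernel v1.11 §16).
* §3 (datum) `endpointExistence_of_foliationLetters_datum` ∕ `_locUpper` ∕ `endpointExistence_of_foliationSign_datum` — `hEnd` for a finite-ε
  datum from the foliation letters of `D.βfun`; `thm2Printed_of_foliationBounds_datum` — `B12.Thm2Printed D.C.toB12 L` from two-sided trace bounds; `endpointExistence_datum_iff_topRuns_folCont` — on non-crossing data that halt outside, `hEnd`
  ⟺ the top-run condition, with (C) ∕ (U) read along the foliation (the datum form of `EndContAlongFoliation.endpointExistence_iff_topRuns_folCont`).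
* §4 (datum on `SU(N)`) the NON-VACUOUS print-faithful headline (`continuumYM4_torus_of_endpointExistence_nonvacuous` BY NAME) from the
  foliation letters: `continuumYM4Torus_of_foliationLetters` ((C), (U), (PS) along the foliation), `continuumYM4Torus_of_foliationSign`
  ((C), per-level (U), SIGN along the foliation).  READING (g1-plan-2 R-37's located remark, made a theorem at the headline): the
  coordinator's binder B4 `hC : FlowStep.BetaContH γc D.βfun` (joint continuity on the boxes `]0,γc]^{k+1}`) is needed by the END roads only as
  continuity in the bare coupling of countably many ONE-variable functions; likewise (U) and the sign ∕ (PS).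
0 sorry; 0 def; imports `T4ContinuumYM4Torus` + `Gaps/EndUpperPerLevel` + `Gaps/EndContAlongFoliation`; restates nothing.  AUTHORSHIP: §1 =
g1-plan-2 GEN 18 (ported verbatim); §2–§4 = this seat's datum-level transport (one-line compositions BY NAME).

CITATION HEADER (tags CONTEXT ONLY).  [I] = T. Bałaban, Commun. Math. Phys. **109** (1987) [Balaban1987RG1]: Thm 2 ∕ (0.31) p. 259,
(0.20) p. 256, §1 pp. 263–264; [II] = Commun. Math. Phys. **122** (1989) [Balaban1989LargeFieldII] p. 355 (Thm 2 «has not been published yet»).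
-/

namespace Summit.QuantumFields.BalabanUV.Gaps.EndFoliationHeadline

open Literature.MathematicalPhysics.QuantumFieldTheory.Balaban1983to89
open Literature.MathematicalPhysics.QuantumFieldTheory.Balaban1983to89.FlowStep
open Literature.MathematicalPhysics.QuantumFieldTheory.Balaban1983to89.FlowStepRuns
open Literature.MathematicalPhysics.QuantumFieldTheory.Balaban1983to89.DagBinding
open Literature.MathematicalPhysics.QuantumFieldTheory.Balaban1983to89.T4Continuum
open Literature.MathematicalPhysics.QuantumFieldTheory.Balaban1983to89.T4ContinuumYM4Torus
open Summit.QuantumFields.BalabanUV.Gaps.EndRunwiseShooting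
open Summit.QuantumFields.BalabanUV.Gaps.EndTopRunCriterion
open Summit.QuantumFields.BalabanUV.Gaps.EndUpperPerLevel
open Summit.QuantumFields.BalabanUV.Gaps.EndContAlongFoliation
open Topology Finset

universe u

noncomputable section

/-! ## §1 Both weakenings at once: (C) along the foliation AND (U) per level along it — (D)'s criterion and the W-β road (g1-plan-2 kernel §13,
ported; `Gaps/EndUpperPerLevel` + `Gaps/EndContAlongFoliation` as black boxes) -/

/-- **… AND WITH (U) PER LEVEL ALONG THE FOLIATION** (`EndUpperPerLevel.endpointExistence_modelOf_iff_topRuns_locUpper` as the black box): (D)'s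
construction-level criterion from {`0 < γ₀`, continuity of the traces, a bound `B_k` on each trace, non-crossing} — both weakenings at once,
no `0 ≤ β′`. [cite: Balaban1987RG1, Thm 2 p.259] -/
theorem endpointExistence_iff_topRuns_foliation_locUpper {C : B12.Construction} {β : HBeta} (hgen : ForwardGenerated C β)
    (hhalt : HaltsOutside C β) (hcur : CurriesHBeta C β) {γ₀ : ℝ} (hγ₀ : 0 < γ₀)
    (hfol : ∀ k : ℕ, ContinuousOn (fun x : ℝ => β k (clampPrefix β γ₀ k x)) (Set.Ioc 0 γ₀))
    (hlocFol : ∀ k : ℕ, ∃ B : ℝ, ∀ x : ℝ, 0 < x → x ≤ γ₀ → β k (clampPrefix β γ₀ k x) ≤ B)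
    (hord : ∀ γ : ℝ, 0 < γ → γ ≤ γ₀ → ∀ (n : ℕ) (gs gs' : ℕ → ℝ), RGEqH n β gs → RGEqH n β gs' →
      Step.InInterval γ n gs → Step.InInterval γ n gs' → gs 0 < gs' 0 → ∀ k, k ≤ n → gs k < gs' k) :
    EndpointExistence C ↔
      ∃ γ₂ : ℝ, 0 < γ₂ ∧ ∀ γ : ℝ, 0 < γ → γ ≤ γ₂ → ∃ gstar : ℝ, 0 < gstar ∧
        ∀ (n : ℕ) (gs : ℕ → ℝ), RGEqH n β gs → Step.InInterval γ n gs → ∀ k, k ≤ n → gs k = γ → gstar ≤ gs n := by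
  have hD := endpointExistence_modelOf_iff_topRuns_locUpper hγ₀ (betaContH_folH hfol) (perLevelUpper_folH hlocFol) (hord_folH hord)
  have h1 : ∀ γ : ℝ, 0 < γ → γ ≤ γ₀ → ∀ (n : ℕ) (gs : ℕ → ℝ), Step.InInterval γ n gs → RGEqH n β gs → RGEqH n (folH β γ₀) gs :=
    fun _ _ hγle _ _ hI hrg => rgEqH_folH_of_rgEqH hγle hrg hI
  have h2 : ∀ γ : ℝ, 0 < γ → γ ≤ γ₀ → ∀ (n : ℕ) (gs : ℕ → ℝ), Step.InInterval γ n gs → RGEqH n (folH β γ₀) gs → RGEqH n β gs :=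
    fun _ _ hγle _ _ hI hrg => rgEqH_of_rgEqH_folH hγle hrg hI
  constructor
  · intro hE
    exact topRuns_of_runs hγ₀ h1 (hD.1 (endpointExistence_of_runs hγ₀ hgen hhalt hcur (modelOf_forwardGenerated _) h1 hE))
  · intro htop
    exact endpointExistence_of_runs hγ₀ (modelOf_forwardGenerated _) (modelOf_haltsOutside _) (modelOf_curries _) hgen h2
      (hD.2 (topRuns_of_runs hγ₀ h2 htop))


/-- The W-β road along the foliation with PER-LEVEL bounds on the traces (`EndUpperPerLevel.endpointExistence_of_partialSums_locUpper` as the black box;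
no `β′`, no `0 ≤ β′`). [cite: Balaban1987RG1, Thm 2 p.259] -/
theorem endpointExistence_of_foliationLetters_locUpper {C : B12.Construction} {β : HBeta} (hgen : ForwardGenerated C β)
    {γ₀ M : ℝ} (hγ₀ : 0 < γ₀) (hM : 0 ≤ M)
    (hfol : ∀ k : ℕ, ContinuousOn (fun x : ℝ => β k (clampPrefix β γ₀ k x)) (Set.Ioc 0 γ₀))
    (hlocFol : ∀ k : ℕ, ∃ B : ℝ, ∀ x : ℝ, 0 < x → x ≤ γ₀ → β k (clampPrefix β γ₀ k x) ≤ B)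
    (hpsFol : ∀ x : ℝ, 0 < x → x ≤ γ₀ → ∀ k n : ℕ, k ≤ n → -M ≤ ∑ j ∈ Finset.Ico k n, β j (clampPrefix β γ₀ j x)) :
    EndpointExistence C :=
  endpointExistence_of_runs hγ₀ (modelOf_forwardGenerated _) (modelOf_haltsOutside _) (modelOf_curries _) hgen
    (fun _ _ hγle _ _ hI hrg => rgEqH_of_rgEqH_folH hγle hrg hI)
    (endpointExistence_of_partialSums_locUpper (modelOf_forwardGenerated (folH β γ₀)) hγ₀ hM (betaContH_folH hfol)
      (betaPartialSumsLowerH_folH hpsFol) (perLevelUpper_folH hlocFol))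

/-! ## §2 The SIGN socket with every letter on the foliation (construction level, `ForwardGenerated` only) -/

/-- **END FROM THE SIGN, A BOUND AND CONTINUITY OF THE ONE-VARIABLE TRACES.**  For a construction generated forward by (0.20) with `β`: if for
every `k` the trace `x ↦ β_k(ĝ(Y_0(x)),…,ĝ(Y_k(x)))` (β along the γ₀-clamped forward shooting prefix from the trial bare coupling `x`) is
CONTINUOUS on `]0,γ₀]`, BOUNDED ABOVE there by some `B_k`, and NON-NEGATIVE there, then `EndpointExistence C` (with `γ₂ = γ₀`, `g⋆ = γ`).
The tree's sign socket `DagBinding.endpointExistence_of_forwardGenerated` asks the three letters on the whole boxes `]0,γ₀]^{k+1}` with a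
uniform bound; here each is asked of countably many one-variable functions (§1's `endpointExistence_of_foliationLetters_locUpper`, `M = 0`). [cite: Balaban1987RG1, Thm 2 p.259 and (0.20) p.256] -/
theorem endpointExistence_of_foliationSign {C : B12.Construction} {β : HBeta} (hgen : ForwardGenerated C β) {γ₀ : ℝ} (hγ₀ : 0 < γ₀)
    (hfol : ∀ k : ℕ, ContinuousOn (fun x : ℝ => β k (clampPrefix β γ₀ k x)) (Set.Ioc 0 γ₀))
    (hlocFol : ∀ k : ℕ, ∃ B : ℝ, ∀ x : ℝ, 0 < x → x ≤ γ₀ → β k (clampPrefix β γ₀ k x) ≤ B)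
    (hsignFol : ∀ (k : ℕ) (x : ℝ), 0 < x → x ≤ γ₀ → 0 ≤ β k (clampPrefix β γ₀ k x)) : EndpointExistence C :=
  endpointExistence_of_foliationLetters_locUpper hgen hγ₀ le_rfl hfol hlocFol fun x hx hxγ k n _ => by
    rw [neg_zero]
    exact Finset.sum_nonneg fun j _ => hsignFol j x hx hxγ

/-! ## §2b [I] Theorem 2's printed shape `B12.Thm2Printed C L` from TWO-SIDED bounds on the one-variable traces (this seat; rows CAP ∕ tail ∕
(D1) ∕ (D4)'s β-input in a weaker placement on the Theorem-2 node (weakest so far in the tree; g1-plan-2's S-48 moves it further, to the survivor sets)) -/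

/-- (0.31)'s LOWER letter along the foliation ⟹ the box lower bound for the restriction `folH` (companion of
`EndContAlongFoliation.betaUpperH_folH`). [folklore] -/
theorem betaLowerH_folH {β : HBeta} {γ₀ b : ℝ}
    (hloFol : ∀ (k : ℕ) (x : ℝ), 0 < x → x ≤ γ₀ → b ≤ β k (clampPrefix β γ₀ k x)) :
    BetaLowerH b γ₀ (folH β γ₀) :=
  fun k v hv => hloFol k (v 0) ((mem_box.mp hv) 0).1 ((mem_box.mp hv) 0).2

/-- … and conversely the box lower bound gives the trace lower bound. [folklore] -/
theorem folLower_of_betaLowerH {β : HBeta} {γ₀ b : ℝ} (hγ₀ : 0 < γ₀) (hlo : BetaLowerH b γ₀ β) :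
    ∀ (k : ℕ) (x : ℝ), 0 < x → x ≤ γ₀ → b ≤ β k (clampPrefix β γ₀ k x) :=
  fun k x _ _ => hlo k _ (clampPrefix_mem_box hγ₀ k x)

/-- `B12.Thm2Printed C L` CONTAINS the END binder `EndpointExistence C` (drop (0.31); same quantifier prefix).  (PORTED VERBATIM, with
attribution, from g1-plan-2 GEN 19's kernel v1.11 3364e01583b84190 §16, where it heads the Theorem-2 survivor census; placed here, import-light,
for the witness leaves.) [cite: Balaban1987RG1, Thm 2 p.259] -/
theorem endpointExistence_of_thm2Printed {C : B12.Construction} {L : ℝ} (h2 : B12.Thm2Printed C L) :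
    EndpointExistence C := by
  intro m
  obtain ⟨γ₂, hγ₂, H⟩ := h2 m
  refine ⟨γ₂, hγ₂, fun γ hγ hγle => ?_⟩
  obtain ⟨gstar, hgstar, Hg⟩ := H γ hγ hγle
  refine ⟨gstar, hgstar, fun g hg hgle K => ?_⟩
  obtain ⟨b, b', -, -, HK⟩ := Hg g hg hgle
  obtain ⟨g0, hI, hK, -⟩ := HK K
  exact ⟨g0, hI, hK⟩

/-- **THEOREM-2 TRANSFER BETWEEN CONSTRUCTIONS WHOSE GENERATING FAMILIES SHARE THEIR IN-INTERVAL RUNS** (levels `≤ γ₀`; the companion of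
`EndContAlongFoliation.endpointExistence_of_runs` for the printed shape (0.31), which reads the FLOWS only): if `C` is forward-generated by
`β`, halts outside and curries `β`, `C′` is forward-generated by `β′`, and every in-interval `β`-run is a `β′`-run, then
`B12.Thm2Printed C L → B12.Thm2Printed C′ L` (same constants; forward uniqueness `FlowStepRuns.flow_eq_of_rgEqH`; `γ₂` shrunk below `γ₀`).
[cite: Balaban1987RG1, Thm 2 (0.31) p.259] -/
theorem thm2Printed_of_runs {C C' : B12.Construction} {β β' : HBeta} {γ₀ L : ℝ} (hγ₀ : 0 < γ₀)
    (hgen : ForwardGenerated C β) (hhalt : HaltsOutside C β) (hcur : CurriesHBeta C β) (hgen' : ForwardGenerated C' β')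
    (hsame : ∀ γ : ℝ, 0 < γ → γ ≤ γ₀ → ∀ (n : ℕ) (gs : ℕ → ℝ), Step.InInterval γ n gs → RGEqH n β gs → RGEqH n β' gs)
    (h2 : B12.Thm2Printed C L) : B12.Thm2Printed C' L := by
  intro m
  obtain ⟨γ₂, hγ₂, H⟩ := h2 m
  refine ⟨min γ₂ γ₀, lt_min hγ₂ hγ₀, fun γ hγ hγle => ?_⟩
  obtain ⟨gstar, hgstar, Hg⟩ := H γ hγ (hγle.trans (min_le_left _ _))
  refine ⟨gstar, hgstar, fun g hg hgle => ?_⟩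
  obtain ⟨b, b', hb, hbb', HK⟩ := Hg g hg hgle
  refine ⟨b, b', hb, hbb', fun K => ?_⟩
  obtain ⟨g0, hIK, hK, hbounds⟩ := HK K
  have hrg : RGEqH K β (C ⟨K, m, g0⟩).flow.g := rgEqH_of_inInterval hgen hhalt hcur ⟨K, m, g0⟩ hIK
  have hrg' : RGEqH K β' (C ⟨K, m, g0⟩).flow.g := hsame γ hγ (hγle.trans (min_le_right _ _)) K _ hIK hrg
  have heq : ∀ k, k ≤ K → (C' ⟨K, m, g0⟩).flow.g k = (C ⟨K, m, g0⟩).flow.g k :=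
    flow_eq_of_rgEqH (C' ⟨K, m, g0⟩).flow β' K (fun k hk => hgen'.2 ⟨K, m, g0⟩ k hk)
      ((hgen'.1 ⟨K, m, g0⟩).trans (hgen.1 ⟨K, m, g0⟩).symm) hrg' (fun k hk => (hIK k hk).1)
  refine ⟨g0, fun k hk => ?_, ?_, fun k hk => ?_⟩
  · rw [heq k hk]; exact hIK k hk
  · rw [heq K le_rfl]; exact hK
  · rw [heq k hk]; exact hbounds k hk

/-- **[I] THEOREM 2's PRINTED SHAPE FROM TWO-SIDED BOUNDS ON THE ONE-VARIABLE TRACES.**  For a construction generated forward by (0.20) with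
`β`, block size `L > 1` (as a real): if for every `k` the trace `x ↦ β_k(ĝ(Y_0(x)),…,ĝ(Y_k(x)))` is CONTINUOUS on `]0,γ₀]` and satisfies
`b ≤ trace ≤ β′` there (`0 < b ≤ β′`), then `B12.Thm2Printed C L` ((0.31) with `β = b∕log L`, `β′∕log L`).  = `FlowStepRuns.thm2Printed_of_boxBoundsH`
(:211: the same three letters on the whole boxes `]0,γ₀]^{k+1}`) applied to the foliation restriction `folH β γ₀` + run equivalence + the
Theorem-2 transfer.  The located unprinted input of rows CAP ∕ tail ∕ (D1) ∕ (D4) (`b > 0` = asymptotic freedom with a uniform constant) is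
thereby asked of countably many ONE-variable functions; a REDUCTION, not a proof of Theorem 2. [cite: Balaban1987RG1, Thm 2 (0.31) p.259] -/
theorem thm2Printed_of_foliationBounds {C : B12.Construction} {β : HBeta} (hgen : ForwardGenerated C β) {L γ₀ b β' : ℝ}
    (hL : 1 < L) (hγ₀ : 0 < γ₀) (hb : 0 < b) (hbβ' : b ≤ β')
    (hfol : ∀ k : ℕ, ContinuousOn (fun x : ℝ => β k (clampPrefix β γ₀ k x)) (Set.Ioc 0 γ₀))
    (hloFol : ∀ (k : ℕ) (x : ℝ), 0 < x → x ≤ γ₀ → b ≤ β k (clampPrefix β γ₀ k x))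
    (hhiFol : ∀ (k : ℕ) (x : ℝ), 0 < x → x ≤ γ₀ → β k (clampPrefix β γ₀ k x) ≤ β') : B12.Thm2Printed C L :=
  thm2Printed_of_runs hγ₀ (modelOf_forwardGenerated _) (modelOf_haltsOutside _) (modelOf_curries _) hgen
    (fun _ _ hγle _ _ hI hrg => rgEqH_of_rgEqH_folH hγle hrg hI)
    (thm2Printed_of_boxBoundsH (modelOf_forwardGenerated (folH β γ₀)) hL hγ₀ hb hbβ' (betaContH_folH hfol)
      (betaLowerH_folH hloFol) (betaUpperH_folH hhiFol))

/-! ## §3 The datum: `hEnd` from the foliation letters of `D.βfun`; `hEnd` ⟺ top runs with (C) ∕ (U) along the foliation -/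

section Datum

variable {F : T4Family} {G : Type u} [GaugeGroup G] [MeasurableSpace G] [HaarData G]

/-- **`hEnd` FROM (C), (U), (PS) ALONG THE FOLIATION** for a finite-ε datum: the traces `x ↦ D.βfun k (clampPrefix D.βfun γ₀ k x)` continuous
on `]0,γ₀]`, `≤ β′` there (`0 ≤ β′`), and with partial sums `≥ −M` along each clamped prefix ⟹ `EndpointExistence D.C.toB12` (forward
generation is the field `D.fwd`).  Weaker binder than W-β's all-history (PS) + box (C) + box (U) (`Gaps/WeakestBetaCurrency.endpointExistence_of_W`)
and than `EndRunwiseCone.endpointExistence_of_shootingPS` (which kept (C), (U) on the boxes). [cite: Balaban1987RG1, Thm 2 p.259] -/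
theorem endpointExistence_of_foliationLetters_datum (D : FiniteEpsData F G) {γ₀ M β' : ℝ} (hγ₀ : 0 < γ₀) (hM : 0 ≤ M) (hβ' : 0 ≤ β')
    (hfol : ∀ k : ℕ, ContinuousOn (fun x : ℝ => D.βfun k (clampPrefix D.βfun γ₀ k x)) (Set.Ioc 0 γ₀))
    (hhiFol : ∀ (k : ℕ) (x : ℝ), 0 < x → x ≤ γ₀ → D.βfun k (clampPrefix D.βfun γ₀ k x) ≤ β')
    (hpsFol : ∀ x : ℝ, 0 < x → x ≤ γ₀ → ∀ k n : ℕ, k ≤ n → -M ≤ ∑ j ∈ Finset.Ico k n, D.βfun j (clampPrefix D.βfun γ₀ j x)) :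
    EndpointExistence D.C.toB12 :=
  endpointExistence_of_foliationLetters D.fwd hγ₀ hM hβ' hfol hhiFol hpsFol

/-- The same with PER-LEVEL bounds on the traces (no `β′`, no `0 ≤ β′`). [cite: Balaban1987RG1, Thm 2 p.259] -/
theorem endpointExistence_of_foliationLetters_locUpper_datum (D : FiniteEpsData F G) {γ₀ M : ℝ} (hγ₀ : 0 < γ₀) (hM : 0 ≤ M)
    (hfol : ∀ k : ℕ, ContinuousOn (fun x : ℝ => D.βfun k (clampPrefix D.βfun γ₀ k x)) (Set.Ioc 0 γ₀))
    (hlocFol : ∀ k : ℕ, ∃ B : ℝ, ∀ x : ℝ, 0 < x → x ≤ γ₀ → D.βfun k (clampPrefix D.βfun γ₀ k x) ≤ B)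
    (hpsFol : ∀ x : ℝ, 0 < x → x ≤ γ₀ → ∀ k n : ℕ, k ≤ n → -M ≤ ∑ j ∈ Finset.Ico k n, D.βfun j (clampPrefix D.βfun γ₀ j x)) :
    EndpointExistence D.C.toB12 :=
  endpointExistence_of_foliationLetters_locUpper D.fwd hγ₀ hM hfol hlocFol hpsFol

/-- **`hEnd` FROM THE SIGN, A BOUND AND CONTINUITY OF THE ONE-VARIABLE TRACES** of the datum's family (§2's `endpointExistence_of_foliationSign` for `D.C.toB12`).
[cite: Balaban1987RG1, Thm 2 p.259] -/
theorem endpointExistence_of_foliationSign_datum (D : FiniteEpsData F G) {γ₀ : ℝ} (hγ₀ : 0 < γ₀)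
    (hfol : ∀ k : ℕ, ContinuousOn (fun x : ℝ => D.βfun k (clampPrefix D.βfun γ₀ k x)) (Set.Ioc 0 γ₀))
    (hlocFol : ∀ k : ℕ, ∃ B : ℝ, ∀ x : ℝ, 0 < x → x ≤ γ₀ → D.βfun k (clampPrefix D.βfun γ₀ k x) ≤ B)
    (hsignFol : ∀ (k : ℕ) (x : ℝ), 0 < x → x ≤ γ₀ → 0 ≤ D.βfun k (clampPrefix D.βfun γ₀ k x)) :
    EndpointExistence D.C.toB12 :=
  endpointExistence_of_foliationSign D.fwd hγ₀ hfol hlocFol hsignFol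

/-- **[I] THM 2's PRINTED SHAPE FOR THE DATUM FROM TWO-SIDED BOUNDS ON THE TRACES**: `0 < b ≤ β′`, and for every `k` the trace
`x ↦ D.βfun k (clampPrefix D.βfun γ₀ k x)` continuous with `b ≤ · ≤ β′` on `]0,γ₀]` ⟹ `B12.Thm2Printed D.C.toB12 L` for every `L > 1` (the block
size lives in the construction).  Versus `EndRunwiseHeadline.thm2Printed_of_coneBounds_datum` (bounds on the running CONE, continuity on the
boxes): here BOTH the bounds and the continuity sit on the one-parameter family. [cite: Balaban1987RG1, Thm 2 (0.31) p.259] -/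
theorem thm2Printed_of_foliationBounds_datum (D : FiniteEpsData F G) {L γ₀ b β' : ℝ} (hL : 1 < L) (hγ₀ : 0 < γ₀) (hb : 0 < b)
    (hbβ' : b ≤ β') (hfol : ∀ k : ℕ, ContinuousOn (fun x : ℝ => D.βfun k (clampPrefix D.βfun γ₀ k x)) (Set.Ioc 0 γ₀))
    (hloFol : ∀ (k : ℕ) (x : ℝ), 0 < x → x ≤ γ₀ → b ≤ D.βfun k (clampPrefix D.βfun γ₀ k x))
    (hhiFol : ∀ (k : ℕ) (x : ℝ), 0 < x → x ≤ γ₀ → D.βfun k (clampPrefix D.βfun γ₀ k x) ≤ β') :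
    B12.Thm2Printed D.C.toB12 L :=
  thm2Printed_of_foliationBounds D.fwd hL hγ₀ hb hbβ' hfol hloFol hhiFol

/-- **`hEnd` ⟺ «NO BACKSLIDING FROM THE TOP» FOR A NON-CROSSING DATUM, WITH (C) AND (U) READ ALONG THE FOLIATION.**  For a finite-ε datum
whose construction halts outside (hypothesis; `D.fwd`, `D.curries` are fields), with the traces of `D.βfun` continuous and bounded (per
level) on `]0,γ₀]` and its in-interval runs non-crossing at every level `γ ≤ γ₀`: `EndpointExistence D.C.toB12 ↔` the top-run condition —
`EndRunwiseHeadline.endpointExistence_datum_iff_topRuns` with box continuity and the uniform box bound replaced by their traces.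
[cite: Balaban1987RG1, Thm 2 p.259] -/
theorem endpointExistence_datum_iff_topRuns_folCont (D : FiniteEpsData F G) (hhalt : HaltsOutside D.C.toB12 D.βfun) {γ₀ : ℝ}
    (hγ₀ : 0 < γ₀) (hfol : ∀ k : ℕ, ContinuousOn (fun x : ℝ => D.βfun k (clampPrefix D.βfun γ₀ k x)) (Set.Ioc 0 γ₀))
    (hlocFol : ∀ k : ℕ, ∃ B : ℝ, ∀ x : ℝ, 0 < x → x ≤ γ₀ → D.βfun k (clampPrefix D.βfun γ₀ k x) ≤ B)
    (hord : ∀ γ : ℝ, 0 < γ → γ ≤ γ₀ → ∀ (n : ℕ) (gs gs' : ℕ → ℝ), RGEqH n D.βfun gs → RGEqH n D.βfun gs' →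
      Step.InInterval γ n gs → Step.InInterval γ n gs' → gs 0 < gs' 0 → ∀ k, k ≤ n → gs k < gs' k) :
    EndpointExistence D.C.toB12 ↔
      ∃ γ₂ : ℝ, 0 < γ₂ ∧ ∀ γ : ℝ, 0 < γ → γ ≤ γ₂ → ∃ gstar : ℝ, 0 < gstar ∧
        ∀ (n : ℕ) (gs : ℕ → ℝ), RGEqH n D.βfun gs → Step.InInterval γ n gs → ∀ k, k ≤ n → gs k = γ → gstar ≤ gs n :=
  endpointExistence_iff_topRuns_foliation_locUpper D.fwd hhalt D.curries hγ₀ hfol hlocFol hord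

end Datum

/-! ## §4 The non-vacuous T⁴ headline from letters on the one-parameter family -/

section DatumSU

variable {F : T4Family} {N : ℕ} [NeZero N]

/-- **THE T⁴ HEADLINE FROM (C), (U), (PS) ALONG THE FOLIATION, NON-VACUOUS** (∀-form ∧ ∃-form): printed-averaged datum on `SU(N)`, (B), the
three letters asked of the one-variable traces of `D.βfun` along the γ₀-clamped forward shooting foliation, and the spine slot under endpoint
existence ⇒ `ContinuumYM4Torus D ∧ ContinuumYM4TorusE D` (= `continuumYM4_torus_of_endpointExistence_nonvacuous` with
`hEnd := endpointExistence_of_foliationLetters_datum …`).  Versus the coordinator's explicit-hypothesis headline, binder B4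
`hC : FlowStep.BetaContH γc D.βfun` (joint continuity on the boxes) has become continuity in the bare coupling of countably many ONE-variable
functions.  Every binder a hypothesis. [cite: Balaban1987RG1, Thm 2 p.259] -/
theorem continuumYM4Torus_of_foliationLetters (D : FiniteEpsData F (Matrix.specialUnitaryGroup (Fin N) ℂ)) (hD : D.IsPrintedAveraged)
    (hB : B16.EndStatementBPrinted D.C) {γ₀ M β' : ℝ} (hγ₀ : 0 < γ₀) (hM : 0 ≤ M) (hβ' : 0 ≤ β')
    (hfol : ∀ k : ℕ, ContinuousOn (fun x : ℝ => D.βfun k (clampPrefix D.βfun γ₀ k x)) (Set.Ioc 0 γ₀))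
    (hhiFol : ∀ (k : ℕ) (x : ℝ), 0 < x → x ≤ γ₀ → D.βfun k (clampPrefix D.βfun γ₀ k x) ≤ β')
    (hpsFol : ∀ x : ℝ, 0 < x → x ≤ γ₀ → ∀ k n : ℕ, k ≤ n → -M ≤ ∑ j ∈ Finset.Ico k n, D.βfun j (clampPrefix D.βfun γ₀ j x))
    (hNE : T4ApexHybrid.HybridNE7Under D (EndpointExistence D.C.toB12)) : ContinuumYM4Torus D ∧ ContinuumYM4TorusE D :=
  continuumYM4_torus_of_endpointExistence_nonvacuous D hD hB
    (endpointExistence_of_foliationLetters_datum D hγ₀ hM hβ' hfol hhiFol hpsFol) hNE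

/-- **THE T⁴ HEADLINE FROM THE SIGN, PER-LEVEL BOUNDS AND CONTINUITY OF THE ONE-VARIABLE TRACES, NON-VACUOUS**: printed-averaged datum on
`SU(N)`, (B), for every `k` the trace `x ↦ D.βfun k (clampPrefix D.βfun γ₀ k x)` continuous, bounded above and non-negative on `]0,γ₀]`, and
the spine slot ⇒ `ContinuumYM4Torus D ∧ ContinuumYM4TorusE D`.  The weakest-placed form of the SIGN road in the tree: versus
`DagBinding.endpointExistence_of_forwardGenerated` (β ≥ 0, (C), uniform (U) on the boxes) every letter sits on the one-parameter family and
the bound is per level.  Every binder a hypothesis; whether Bałaban's β meets them is [I] Thm 2's unprinted input. [cite: Balaban1987RG1, Thm 2 p.259] -/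
theorem continuumYM4Torus_of_foliationSign (D : FiniteEpsData F (Matrix.specialUnitaryGroup (Fin N) ℂ)) (hD : D.IsPrintedAveraged)
    (hB : B16.EndStatementBPrinted D.C) {γ₀ : ℝ} (hγ₀ : 0 < γ₀)
    (hfol : ∀ k : ℕ, ContinuousOn (fun x : ℝ => D.βfun k (clampPrefix D.βfun γ₀ k x)) (Set.Ioc 0 γ₀))
    (hlocFol : ∀ k : ℕ, ∃ B : ℝ, ∀ x : ℝ, 0 < x → x ≤ γ₀ → D.βfun k (clampPrefix D.βfun γ₀ k x) ≤ B)
    (hsignFol : ∀ (k : ℕ) (x : ℝ), 0 < x → x ≤ γ₀ → 0 ≤ D.βfun k (clampPrefix D.βfun γ₀ k x))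
    (hNE : T4ApexHybrid.HybridNE7Under D (EndpointExistence D.C.toB12)) : ContinuumYM4Torus D ∧ ContinuumYM4TorusE D :=
  continuumYM4_torus_of_endpointExistence_nonvacuous D hD hB
    (endpointExistence_of_foliationSign_datum D hγ₀ hfol hlocFol hsignFol) hNE

end DatumSU

end

end Summit.QuantumFields.BalabanUV.Gaps.EndFoliationHeadline
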